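import Summits.ResolutionOfSingularities.ResolutionOfSingularities.Theorems.UniformComplexityCampaignW82FamilyResolutionGraded
import Summits.ResolutionOfSingularities.ResolutionOfSingularities.Theorems.UniformComplexityPrimeModelTransferFamilyResolutionSpread
import Literature.AlgebraicGeometry.Resolution.ResolutionOfCurves
import Mathlib.FieldTheory.IsAlgClosed.AlgebraicClosure
import HarnessLib

/-!
# Crux `PrimeModelTransfer` (stmt-ResolutionOfSingularities-8933), door 2 of slot W8.2:
# RESOLUTION IN FAMILIES holds for families of CURVES (unconditionally) and in fibre dimension `≤ 3`
# (modulo F-02) — the rungs of the family form, by name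

Route `ResolutionOfSingularities/UniformComplexity`. The family form of the crux
(`CampaignW82.FamilyResolution`, p526769; `↔` crux slice, p530650) graded by the fibre dimension
(`CampaignW82.FamilyResolutionDimLe k n`, OURS module `…FamilyResolutionGraded.lean`). By the spreading
theorem `PrimeModelTransfer.exists_familyResolution_datum` (p529834) the family-resolution datum of a
proper family exists as soon as its geometric generic fibre — an integral proper scheme over the
ALGEBRAICALLY CLOSED field `(Frac A)^{alg}` — has a resolution; so:

* `familyResolutionDimLe_one` — **`FamilyResolutionDimLe k 1` for EVERY field `k`**, unconditionally:
  curves over a field have resolutions (normalisation; tree `Resolution.hasResolution_of_dim_le_one`,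
  Hartshorne V Rem. 3.8.1). In words: every proper family of curves `𝒳 → Spec A` over a finitely
  generated domain, with integral geometric generic fibre, acquires after a finite-type ALGEBRAIC
  injective base extension `A → A'` ONE morphism `G : 𝒴 → 𝒳 ×_A Spec A'` all of whose field-valued
  fibres are weak resolutions (proper, regular — indeed smooth — source, isomorphism over a non-empty
  open): simultaneous resolution of the fibres of a curve fibration, generically on the base, after an
  inseparable-allowed algebraic base change.
* `familyResolutionDimLe_three_of_cossartPiltant` — `CossartPiltant2019 → FamilyResolutionDimLe k 3`
  for every field `k` (conditional on the undischarged named fact F-02, `CossartPiltant2019`, taken as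
  a hypothesis: resolution in dimension `≤ 3` over any field).
* `familyResolutionDimLe_of_le_one`, `familyResolutionDimLe_of_le_three_of_cossartPiltant` — all grades
  `n ≤ 1`, resp. `n ≤ 3`.

First open grade: `FamilyResolutionDimLe k 4` for `k` of positive characteristic (equivalently, by the
spreading theorem, resolution of the 4-dimensional integral proper schemes over the fields
`(Frac A)^{alg}`, `A` a finitely generated `k`-domain).

[OURS · LADDER-RESOLUTION L1, slot W8.2 (prime-field / universality transfer), door 2
UniformComplexity] Theorems over the summit's own route and OURS names; NOT statements of, and
attributing nothing to, Hironaka's 2017 manuscript. AI-written; weaker than expert review. Theses-free.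
The `≤ 3` rung is CONDITIONAL on the named fact `CossartPiltant2019` (hypothesis `h`), not a theorem
outright.

Sources: R. Hartshorne, *Algebraic Geometry* (1977) V Rem. 3.8.1 (resolution of curves); V. Cossart,
O. Piltant, J. Algebra 529 (2019) Thm. 1.1 (dimension `≤ 3`, named fact); EGA IV₃ (1966) Thm. 8.10.5.
[cite: Hartshorne1977, Ch. V Rem. 3.8.1] [cite: CossartPiltant2019, Thm. 1.1] [cite: EGAIV3, Thm. 8.10.5]
-/

noncomputable section

set_option linter.dupNamespace false -- mandated namespace of this single-conjunct summit

open CategoryTheory CategoryTheory.Limits AlgebraicGeometry TopologicalSpace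
open Literature.AlgebraicGeometry.Resolution

namespace Summit.ResolutionOfSingularities.ResolutionOfSingularities.Theorems.CampaignW82

/-- The geometric generic fibre field `(Frac A)^{alg}` of a domain `A`: algebraic over `A` with injective
structure map (bookkeeping for the rungs). [folklore] -/
theorem algebraicClosure_fractionRing_isAlgebraic_injective (A : Type) [CommRing A] [IsDomain A] :
    Algebra.IsAlgebraic A (AlgebraicClosure (FractionRing A)) ∧
      Function.Injective (algebraMap A (AlgebraicClosure (FractionRing A))) := by
  haveI : Algebra.IsAlgebraic A (FractionRing A) :=
    IsLocalization.isAlgebraic (FractionRing A) (nonZeroDivisors A)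
  refine ⟨Algebra.IsAlgebraic.trans A (FractionRing A) (AlgebraicClosure (FractionRing A)), ?_⟩
  rw [IsScalarTower.algebraMap_eq A (FractionRing A) (AlgebraicClosure (FractionRing A))]
  exact (algebraMap (FractionRing A) (AlgebraicClosure (FractionRing A))).injective.comp
    (IsFractionRing.injective A (FractionRing A))

/-- **RESOLUTION IN FAMILIES HOLDS FOR FAMILIES OF CURVES, over every field.**
`FamilyResolutionDimLe k 1`: the geometric generic fibre of a proper family with integral geometric
generic fibre of dimension `≤ 1` is an integral curve over the algebraically closed (hence perfect)
field `(Frac A)^{alg}`, resolved by `hasResolution_of_dim_le_one`; the spreading theorem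
`PrimeModelTransfer.exists_familyResolution_datum` (p529834) does the rest.
[cite: Hartshorne1977, Ch. V Rem. 3.8.1] [cite: EGAIV3, Thm. 8.10.5] -/
theorem familyResolutionDimLe_one (k : Type) [Field k] : FamilyResolutionDimLe k 1 := by
  intro A _ _ _ hAft 𝒳 f hf hint hdim
  haveI := hAft
  haveI := hf
  haveI : IsNoetherianRing A := Algebra.FiniteType.isNoetherianRing k A
  obtain ⟨halg, hAL⟩ := algebraicClosure_fractionRing_isAlgebraic_injective A
  haveI := halg
  haveI : PerfectField (AlgebraicClosure (FractionRing A)) :=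
    IsAlgClosed.perfectField (AlgebraicClosure (FractionRing A))
  haveI := hint
  have hY : Scheme.HasResolution (pullback f (Spec.map (CommRingCat.ofHom
      (algebraMap A (AlgebraicClosure (FractionRing A)))))) :=
    hasResolution_of_dim_le_one _
      (pullback.snd f (Spec.map (CommRingCat.ofHom (algebraMap A (AlgebraicClosure (FractionRing A))))))
      hdim
  exact PrimeModelTransfer.exists_familyResolution_datum A (AlgebraicClosure (FractionRing A)) hAL 𝒳 f
    hint hY

/-- All grades `n ≤ 1` (antitonicity). [folklore] -/
theorem familyResolutionDimLe_of_le_one (k : Type) [Field k] {n : WithBot ℕ∞} (hn : n ≤ 1) :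
    FamilyResolutionDimLe k n :=
  familyResolutionDimLe_anti k hn (familyResolutionDimLe_one k)

/-- **RESOLUTION IN FAMILIES IN FIBRE DIMENSION `≤ 3`, modulo F-02.** Assuming the named fact
`CossartPiltant2019` (resolution of reduced separated finite-type schemes of dimension `≤ 3` over any
field — a hypothesis `h`, NOT discharged in the tree), `FamilyResolutionDimLe k 3` holds for every field
`k`: the geometric generic fibre is resolved by `hasResolution_of_dim_le_three h` over `(Frac A)^{alg}`
(a field of some characteristic `ringChar`), then spread by
`PrimeModelTransfer.exists_familyResolution_datum`. CONDITIONAL result (F-02).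
[cite: CossartPiltant2019, Thm. 1.1] [cite: EGAIV3, Thm. 8.10.5] -/
theorem familyResolutionDimLe_three_of_cossartPiltant (h : CossartPiltant2019.{0}) (k : Type) [Field k] :
    FamilyResolutionDimLe k 3 := by
  intro A _ _ _ hAft 𝒳 f hf hint hdim
  haveI := hAft
  haveI := hf
  haveI : IsNoetherianRing A := Algebra.FiniteType.isNoetherianRing k A
  obtain ⟨halg, hAL⟩ := algebraicClosure_fractionRing_isAlgebraic_injective A
  haveI := halg
  haveI : PerfectField (AlgebraicClosure (FractionRing A)) :=
    IsAlgClosed.perfectField (AlgebraicClosure (FractionRing A))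
  haveI := hint
  haveI : CharP (AlgebraicClosure (FractionRing A)) (ringChar (AlgebraicClosure (FractionRing A))) :=
    ringChar.charP _
  have hY : Scheme.HasResolution (pullback f (Spec.map (CommRingCat.ofHom
      (algebraMap A (AlgebraicClosure (FractionRing A)))))) :=
    hasResolution_of_dim_le_three h (p := ringChar (AlgebraicClosure (FractionRing A)))
      (AlgebraicClosure (FractionRing A)) _
      (pullback.snd f (Spec.map (CommRingCat.ofHom (algebraMap A (AlgebraicClosure (FractionRing A))))))
      hdim
  exact PrimeModelTransfer.exists_familyResolution_datum A (AlgebraicClosure (FractionRing A)) hAL 𝒳 f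
    hint hY

/-- All grades `n ≤ 3`, modulo F-02. [cite: CossartPiltant2019, Thm. 1.1] -/
theorem familyResolutionDimLe_of_le_three_of_cossartPiltant (h : CossartPiltant2019.{0}) (k : Type)
    [Field k] {n : WithBot ℕ∞} (hn : n ≤ 3) : FamilyResolutionDimLe k n :=
  familyResolutionDimLe_anti k hn (familyResolutionDimLe_three_of_cossartPiltant h k)

end Summit.ResolutionOfSingularities.ResolutionOfSingularities.Theorems.CampaignW82

end
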